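import Mathlib.LinearAlgebra.Matrix.NonsingularInverse
import Mathlib.LinearAlgebra.Matrix.Trace
import Literature.Computability.AlgebraicComplexity.SmallFormatRank
import HarnessLib

/-!
# de Groote's uniqueness theorem for `2 × 2` matrix multiplication

H. F. de Groote, *On varieties of optimal algorithms for the computation of bilinear mappings.
II. Optimal algorithms for `2×2`-matrix multiplication*, Theoret. Comput. Sci. 7 (1978) 127–148
(with the isotropy group from part I, ibid. 1–24): every optimal (length `7`) bilinear algorithm
for the product of `2 × 2` matrices is equivalent to Strassen's under the isotropy group of
`⟨2,2,2⟩` ("there is essentially one unique bilinear algorithm for the multiplication in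
`k^{2×2}`", Bürgisser–Clausen–Shokrollahi, *Algebraic Complexity Theory*, Chap. 17 Notes).
In the language of tensor decompositions (J. M. Landsberg, *Geometry and Complexity Theory*,
CUP 2017, Thm. 4.3.1.1 [dG78]): the set of rank-seven decompositions of `M_⟨2⟩` is the orbit
`G_{M_⟨2⟩} · Str`; and in the sharpened printed form vendored here (Landsberg 2017,
**Prop. 4.3.1.5** [Burichenko 2014; Chiantini–Ikenmeyer–Landsberg–Ottaviani 2016], derived there
from Thm. 4.3.1.1 and Exercise 4.3.1.4): **the set of rank-seven decompositions of `M_⟨2⟩` is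
`PGL₂ × PGL₂ × PGL₂ · Str`** — the "sandwiching" subgroup alone acts transitively.

Contents (tree vocabulary `matMulTensor` / `triad` of `MatrixMultiplicationExponent.lean`, Strassen's
decomposition `strassenW/U/V` of `SmallFormatRank.lean`; first slot = output/`Z`, second = `X`,
third = `Y`, `⟨2,2,2⟩ (κ,ν) (κ,μ) (μ,ν) = 1`, so that a decomposition
`⟨2,2,2⟩ = Σᵢ Wᵢ ⊗ Uᵢ ⊗ Vᵢ` is the bilinear algorithm `XY = Σᵢ ⟨Uᵢ,X⟩⟨Vᵢ,Y⟩ Wᵢ`,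
`⟨U,X⟩ = Σ U_b X_b`):
* `toMat`/`ofMat`, `frob` — coefficient arrays on `Fin 2 × Fin 2` as `2 × 2` matrices and their
  Frobenius pairing; `trilin S z x y = Σ S_{abc} z_a x_b y_c` — a tensor as a trilinear form,
  with `trilin ⟨2,2,2⟩ z x y = tr(X Y Zᵀ)` (`trilin_matMulTensor_two`);
* `sandwichU P Q`, `sandwichV Q R`, `sandwichW P R` — the SANDWICH ACTION of
  `(P, Q, R) ∈ GL₂³`: `U ↦ P U Q`, `V ↦ Q⁻¹ V R`, `W ↦ P⁻ᵀ W R⁻ᵀ`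
  (i.e. the substitution `X ↦ Pᵀ X Qᵀ`, `Y ↦ Q⁻ᵀ Y Rᵀ` in the algorithm);
* `matMulTensor_two_eq_sum_triad_sandwich` (PROVED) — the action maps decompositions of
  `⟨2,2,2⟩` (of any length) to decompositions: it IS a group of symmetries of the tensor in the
  tree's index conventions (the faithfulness check on the definitions below);
* `DeGroote1978_uniqueness` (NAMED FACT; printed: Landsberg 2017 Prop. 4.3.1.5, over `ℂ`) —
  every rank-`7` decomposition of `⟨2,2,2⟩` over `ℂ` is, term by term after a permutation of
  `Fin 7`, the sandwich transform of Strassen's by some `(P, Q, R) ∈ GL₂(ℂ)³` (equality of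
  rank-one TENSORS, so the per-factor rescalings `λ·μ·ν = 1` are built in).

Not here: de Groote's proof (a 20-page case analysis on the types `(rk U, rk V)` of the products),
part (b) of his theorem (the algorithm variety has dimension `9`), the full stabiliser `Γ_Str`
(Burichenko), other ground fields.

## References

* H. F. de Groote, Theoret. Comput. Sci. 7 (1978) 127–148: Theorem of §2, part (a), with
  Prop. 2.11 and Remark 4.2 [DeGroote1978]; part I, ibid. 1–24 (isotropy group) [Degroote1978].
* J. M. Landsberg, *Geometry and Complexity Theory*, Cambridge Univ. Press 2017, §4.3.1,
  Thm. 4.3.1.1, Exercise 4.3.1.4, Prop. 4.3.1.5 (pp. 92–93 of the held copy). [Landsberg2017]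
* P. Bürgisser, M. Clausen, M. A. Shokrollahi, *Algebraic Complexity Theory*, Springer 1997,
  Chap. 17, Notes ("De Groote [216] has shown that this action is transitive for `A = k^{2×2}`").
-/

namespace Literature.Computability.AlgebraicComplexity

open scoped BigOperators Matrix

/-! ### Coefficient arrays as matrices; the Frobenius pairing; trilinear evaluation -/

section Arrays

variable {K : Type*}

/-- A coefficient array on `Fin 2 × Fin 2` read as a `2 × 2` matrix. [folklore] -/
def toMat (u : Fin 2 × Fin 2 → K) : Matrix (Fin 2) (Fin 2) K := Matrix.of fun i j => u (i, j)

/-- A `2 × 2` matrix read as a coefficient array on `Fin 2 × Fin 2`. [folklore] -/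
def ofMat (M : Matrix (Fin 2) (Fin 2) K) : Fin 2 × Fin 2 → K := fun p => M p.1 p.2

/-- `toMat` after `ofMat` is the identity. [folklore] -/
@[simp] theorem toMat_ofMat (M : Matrix (Fin 2) (Fin 2) K) : toMat (ofMat M) = M := by
  ext i j; rfl

/-- `ofMat` after `toMat` is the identity. [folklore] -/
@[simp] theorem ofMat_toMat (u : Fin 2 × Fin 2 → K) : ofMat (toMat u) = u := by
  funext p; rfl

/-- Entries of `toMat`. [folklore] -/
@[simp] theorem toMat_apply (u : Fin 2 × Fin 2 → K) (i j : Fin 2) : toMat u i j = u (i, j) := rfl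

/-- Entries of `ofMat`. [folklore] -/
@[simp] theorem ofMat_apply (M : Matrix (Fin 2) (Fin 2) K) (p : Fin 2 × Fin 2) :
    ofMat M p = M p.1 p.2 := rfl

variable [CommRing K]

/-- The Frobenius pairing `⟨M, N⟩ = Σᵢⱼ Mᵢⱼ Nᵢⱼ` of two `2 × 2` matrices. [folklore] -/
def frob (M N : Matrix (Fin 2) (Fin 2) K) : K := ∑ i, ∑ j, M i j * N i j

/-- The pairing `Σ_p u_p x_p` of coefficient arrays is the Frobenius pairing of their matrices.
[folklore] -/
theorem sum_mul_eq_frob (u x : Fin 2 × Fin 2 → K) :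
    ∑ p, u p * x p = frob (toMat u) (toMat x) := by
  rw [Fintype.sum_prod_type]
  rfl

/-- **Adjunction for two-sided multiplication**: `⟨P M Q, X⟩ = ⟨M, Pᵀ X Qᵀ⟩`. [folklore] -/
theorem frob_mul_mul (P M Q X : Matrix (Fin 2) (Fin 2) K) :
    frob (P * M * Q) X = frob M (Pᵀ * X * Qᵀ) := by
  simp only [frob, Matrix.mul_apply, Matrix.transpose_apply, Fin.sum_univ_two]
  ring

/-- A `3`-tensor on `(Fin 2 × Fin 2)³` as a trilinear form: `Σ_{a,b,c} S a b c · z a · x b · y c`.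
[folklore] -/
def trilin (S : (Fin 2 × Fin 2) → (Fin 2 × Fin 2) → (Fin 2 × Fin 2) → K)
    (z x y : Fin 2 × Fin 2 → K) : K :=
  ∑ a, ∑ b, ∑ c, S a b c * z a * x b * y c

/-- The trilinear form on coordinate vectors recovers the entries: a tensor is determined by its
trilinear form. [folklore] -/
theorem trilin_single (S : (Fin 2 × Fin 2) → (Fin 2 × Fin 2) → (Fin 2 × Fin 2) → K)
    (a b c : Fin 2 × Fin 2) :
    trilin S (Pi.single a 1) (Pi.single b 1) (Pi.single c 1) = S a b c := by
  classical
  unfold trilin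
  rw [Finset.sum_eq_single a, Finset.sum_eq_single b, Finset.sum_eq_single c]
  · simp
  · intro c' _ hc'; simp [hc']
  · simp
  · intro b' _ hb'; simp [hb']
  · simp
  · intro a' _ ha'; simp [ha']
  · simp

/-- Two tensors with the same trilinear form are equal. [folklore] -/
theorem eq_of_trilin_eq {S S' : (Fin 2 × Fin 2) → (Fin 2 × Fin 2) → (Fin 2 × Fin 2) → K}
    (h : ∀ z x y, trilin S z x y = trilin S' z x y) : S = S' := by
  funext a b c
  rw [← trilin_single S a b c, ← trilin_single S' a b c, h]

/-- The trilinear form of a sum of triads: `Σᵢ ⟨wᵢ, z⟩ ⟨uᵢ, x⟩ ⟨vᵢ, y⟩`. [folklore] -/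
theorem trilin_sum_triad {r : ℕ} (w u v : Fin r → Fin 2 × Fin 2 → K)
    (z x y : Fin 2 × Fin 2 → K) :
    trilin (∑ i, triad (w i) (u i) (v i)) z x y =
      ∑ i, (∑ a, w i a * z a) * (∑ b, u i b * x b) * (∑ c, v i c * y c) := by
  unfold trilin
  have hexp : ∀ i : Fin r, (∑ a, w i a * z a) * (∑ b, u i b * x b) * (∑ c, v i c * y c) =
      ∑ a, ∑ b, ∑ c, w i a * u i b * v i c * z a * x b * y c := by
    intro i
    rw [Finset.sum_mul_sum, Finset.sum_mul]
    refine Finset.sum_congr rfl fun a _ => ?_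
    rw [Finset.sum_mul]
    refine Finset.sum_congr rfl fun b _ => ?_
    rw [Finset.mul_sum]
    refine Finset.sum_congr rfl fun c _ => ?_
    ring
  simp_rw [hexp, Finset.sum_apply, triad_apply, Finset.sum_mul]
  conv_rhs => rw [Finset.sum_comm]
  refine Finset.sum_congr rfl fun a _ => ?_
  conv_rhs => rw [Finset.sum_comm]
  refine Finset.sum_congr rfl fun b _ => ?_
  conv_rhs => rw [Finset.sum_comm]

/-- **The matrix multiplication tensor as a trilinear form**: `Σ ⟨2,2,2⟩_{abc} z_a x_b y_c =
Σ_{κ,μ,ν} z_{κν} x_{κμ} y_{μν} = tr(X Y Zᵀ)`. [cite: Blaser2013, §5 (the tensor ⟨k,m,n⟩)] -/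
theorem trilin_matMulTensor_two (z x y : Fin 2 × Fin 2 → K) :
    trilin (matMulTensor K 2 2 2) z x y = Matrix.trace (toMat x * toMat y * (toMat z)ᵀ) := by
  simp only [trilin, matMulTensor, Fintype.sum_prod_type, Fin.sum_univ_two, Matrix.trace,
    Matrix.diag, Matrix.mul_apply, Matrix.transpose_apply, toMat_apply, Fin.isValue]
  simp
  ring

end Arrays

/-! ### The sandwich action -/

section Sandwich

variable {K : Type*} [Field K]

/-- Sandwich action on the `X`-slot factor: `U ↦ P U Q`. [cite: Degroote1978, §3 (sandwiching)] -/
def sandwichU (P Q : Matrix (Fin 2) (Fin 2) K) (u : Fin 2 × Fin 2 → K) : Fin 2 × Fin 2 → K :=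
  ofMat (P * toMat u * Q)

/-- Sandwich action on the `Y`-slot factor: `V ↦ Q⁻¹ V R`. [cite: Degroote1978, §3 (sandwiching)] -/
noncomputable def sandwichV (Q R : Matrix (Fin 2) (Fin 2) K) (v : Fin 2 × Fin 2 → K) :
    Fin 2 × Fin 2 → K :=
  ofMat (Q⁻¹ * toMat v * R)

/-- Sandwich action on the output (`Z`-slot) factor: `W ↦ P⁻ᵀ W R⁻ᵀ`.
[cite: Degroote1978, §3 (sandwiching)] -/
noncomputable def sandwichW (P R : Matrix (Fin 2) (Fin 2) K) (w : Fin 2 × Fin 2 → K) :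
    Fin 2 × Fin 2 → K :=
  ofMat ((Pᵀ)⁻¹ * toMat w * (Rᵀ)⁻¹)

/-- **The sandwich action preserves decompositions of `⟨2,2,2⟩`**: if
`⟨2,2,2⟩ = Σᵢ Wᵢ ⊗ Uᵢ ⊗ Vᵢ` then, for `P, Q, R` invertible,
`⟨2,2,2⟩ = Σᵢ (P⁻ᵀWᵢR⁻ᵀ) ⊗ (P Uᵢ Q) ⊗ (Q⁻¹VᵢR)` — substituting `X ↦ PᵀXQᵀ`, `Y ↦ Q⁻ᵀYRᵀ` in the
algorithm `XY = Σᵢ ⟨Uᵢ,X⟩⟨Vᵢ,Y⟩Wᵢ` (de Groote's `Γ°`, Landsberg's `PGL₂^{×3}`).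
[cite: Landsberg2017, §4.3.1 (the Strassen family, PGL(U)×PGL(V)×PGL(W))] -/
theorem matMulTensor_two_eq_sum_triad_sandwich {r : ℕ} {w u v : Fin r → Fin 2 × Fin 2 → K}
    (h : matMulTensor K 2 2 2 = ∑ i, triad (w i) (u i) (v i)) (P Q R : Matrix (Fin 2) (Fin 2) K)
    (hP : IsUnit P.det) (hQ : IsUnit Q.det) (hR : IsUnit R.det) :
    matMulTensor K 2 2 2 =
      ∑ i, triad (sandwichW P R (w i)) (sandwichU P Q (u i)) (sandwichV Q R (v i)) := by
  have hPt : IsUnit Pᵀ.det := by rwa [Matrix.det_transpose]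
  have hQt : IsUnit Qᵀ.det := by rwa [Matrix.det_transpose]
  have hRt : IsUnit Rᵀ.det := by rwa [Matrix.det_transpose]
  refine eq_of_trilin_eq fun z x y => ?_
  -- substituted arguments
  set z' : Fin 2 × Fin 2 → K := ofMat (P⁻¹ * toMat z * R⁻¹) with hz'
  set x' : Fin 2 × Fin 2 → K := ofMat (Pᵀ * toMat x * Qᵀ) with hx'
  set y' : Fin 2 × Fin 2 → K := ofMat ((Qᵀ)⁻¹ * toMat y * Rᵀ) with hy'
  have hkey : trilin (matMulTensor K 2 2 2) z' x' y' =
      trilin (∑ i, triad (w i) (u i) (v i)) z' x' y' := by rw [← h]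
  rw [trilin_sum_triad] at hkey
  rw [trilin_sum_triad]
  -- each transformed pairing is a pairing with a substituted argument
  have hU : ∀ i, ∑ b, sandwichU P Q (u i) b * x b = ∑ b, u i b * x' b := by
    intro i
    rw [sum_mul_eq_frob, sum_mul_eq_frob, sandwichU, toMat_ofMat, hx', toMat_ofMat, frob_mul_mul]
  have hV : ∀ i, ∑ c, sandwichV Q R (v i) c * y c = ∑ c, v i c * y' c := by
    intro i
    rw [sum_mul_eq_frob, sum_mul_eq_frob, sandwichV, toMat_ofMat, hy', toMat_ofMat, frob_mul_mul,
      Matrix.transpose_nonsing_inv]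
  have hW : ∀ i, ∑ a, sandwichW P R (w i) a * z a = ∑ a, w i a * z' a := by
    intro i
    rw [sum_mul_eq_frob, sum_mul_eq_frob, sandwichW, toMat_ofMat, hz', toMat_ofMat, frob_mul_mul,
      Matrix.transpose_nonsing_inv, Matrix.transpose_nonsing_inv, Matrix.transpose_transpose,
      Matrix.transpose_transpose]
  simp_rw [hU, hV, hW]
  rw [← hkey, trilin_matMulTensor_two, trilin_matMulTensor_two, hx', hy', hz', toMat_ofMat,
    toMat_ofMat, toMat_ofMat]
  -- tr (PᵀXQᵀ · Qᵀ⁻¹YRᵀ · (P⁻¹ZR⁻¹)ᵀ) = tr (X Y Zᵀ)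
  rw [Matrix.transpose_mul, Matrix.transpose_mul, Matrix.transpose_nonsing_inv,
    Matrix.transpose_nonsing_inv]
  have e1 : Pᵀ * toMat x * Qᵀ * ((Qᵀ)⁻¹ * toMat y * Rᵀ) * ((Rᵀ)⁻¹ * ((toMat z)ᵀ * (Pᵀ)⁻¹)) =
      Pᵀ * (toMat x * (Qᵀ * (Qᵀ)⁻¹) * toMat y * (Rᵀ * (Rᵀ)⁻¹) * (toMat z)ᵀ) * (Pᵀ)⁻¹ := by
    simp only [Matrix.mul_assoc]
  rw [e1, Matrix.mul_nonsing_inv _ hQt, Matrix.mul_nonsing_inv _ hRt, Matrix.mul_one,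
    Matrix.mul_one]
  conv_rhs => rw [Matrix.trace_mul_comm, ← Matrix.mul_assoc, Matrix.nonsing_inv_mul _ hPt,
    Matrix.one_mul]

/-- Sanity instance of the proved symmetry: the sandwich transforms of Strassen's decomposition are
decompositions of `⟨2,2,2⟩`. [cite: Landsberg2017, §4.3.1] -/
theorem matMulTensor_two_eq_sum_sandwich_strassen (P Q R : Matrix (Fin 2) (Fin 2) K)
    (hP : IsUnit P.det) (hQ : IsUnit Q.det) (hR : IsUnit R.det) :
    matMulTensor K 2 2 2 = ∑ i, triad (sandwichW P R (strassenW K i))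
      (sandwichU P Q (strassenU K i)) (sandwichV Q R (strassenV K i)) :=
  matMulTensor_two_eq_sum_triad_sandwich (matMulTensor_two_eq_sum_strassen K) P Q R hP hQ hR

end Sandwich

/-! ### The named fact -/

/-- NAMED FACT — **de Groote's uniqueness theorem for `2 × 2` matrix multiplication**, in the
sharpened printed form of Landsberg 2017, Prop. 4.3.1.5 ("The set of rank seven decompositions of
`M_⟨2⟩` is `PGL₂^{×3} · Str`", attributed there to Burichenko 2014 and
Chiantini–Ikenmeyer–Landsberg–Ottaviani 2016 and derived from Thm. 4.3.1.1 = de Groote 1978: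
"The set of rank seven decompositions of `M_⟨2⟩` is the orbit `G_{M_⟨2⟩} · Str`"), over `ℂ`:
for every decomposition `⟨2,2,2⟩ = Σ_{i<7} wᵢ ⊗ uᵢ ⊗ vᵢ` into seven triads there are invertible
`P, Q, R ∈ ℂ^{2×2}` and a permutation `π` of `Fin 7` such that, for every `i`, the rank-one tensor
`wᵢ ⊗ uᵢ ⊗ vᵢ` is the sandwich transform `(P⁻ᵀ W R⁻ᵀ) ⊗ (P U Q) ⊗ (Q⁻¹ V R)` of Strassen's
`π(i)`-th term `W ⊗ U ⊗ V = strassenW π(i) ⊗ strassenU π(i) ⊗ strassenV π(i)` (equality of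
tensors: the per-factor rescalings with product `1` are absorbed).  The converse inclusion —
every such transform IS a decomposition — is the proved `matMulTensor_two_eq_sum_sandwich_strassen`.
Users take `(h : DeGroote1978_uniqueness)`. [cite: Landsberg2017, Prop. 4.3.1.5 (with Thm. 4.3.1.1 = de Groote 1978)] -/
def DeGroote1978_uniqueness : Prop :=
  ∀ (w u v : Fin 7 → Fin 2 × Fin 2 → ℂ),
    matMulTensor ℂ 2 2 2 = ∑ i, triad (w i) (u i) (v i) →
    ∃ (P Q R : Matrix (Fin 2) (Fin 2) ℂ), IsUnit P.det ∧ IsUnit Q.det ∧ IsUnit R.det ∧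
      ∃ π : Equiv.Perm (Fin 7), ∀ i : Fin 7,
        triad (w i) (u i) (v i) =
          triad (sandwichW P R (strassenW ℂ (π i))) (sandwichU P Q (strassenU ℂ (π i)))
            (sandwichV Q R (strassenV ℂ (π i)))

/-- The orbit statement implies de Groote's original formulation "equivalent to Strassen's
algorithm": the decomposition, reindexed by `π⁻¹`, is the sandwich transform of Strassen's, term
by term; in particular it consists of the SAME seven rank-one tensors as that transform.
[cite: DeGroote1978, §2 Theorem (a)] -/
theorem DeGroote1978_uniqueness.exists_eq_sum_reindex (h : DeGroote1978_uniqueness)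
    (w u v : Fin 7 → Fin 2 × Fin 2 → ℂ)
    (hd : matMulTensor ℂ 2 2 2 = ∑ i, triad (w i) (u i) (v i)) :
    ∃ (P Q R : Matrix (Fin 2) (Fin 2) ℂ), IsUnit P.det ∧ IsUnit Q.det ∧ IsUnit R.det ∧
      ∃ π : Equiv.Perm (Fin 7), ∀ j : Fin 7,
        triad (w (π.symm j)) (u (π.symm j)) (v (π.symm j)) =
          triad (sandwichW P R (strassenW ℂ j)) (sandwichU P Q (strassenU ℂ j))
            (sandwichV Q R (strassenV ℂ j)) := by
  obtain ⟨P, Q, R, hP, hQ, hR, π, hπ⟩ := h w u v hd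
  refine ⟨P, Q, R, hP, hQ, hR, π, fun j => ?_⟩
  simpa using hπ (π.symm j)

end Literature.Computability.AlgebraicComplexity
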